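import Summits.AtomisticToContinuum.HydrodynamicLimit.Theses.JParityClosure
import Summits.AtomisticToContinuum.HydrodynamicLimit.Theses.ImplosionDichotomy
import Summits.AtomisticToContinuum.HydrodynamicLimit.Theses.AdiabaticParcels
import Literature.MathematicalPhysics.KineticTheory.HardSphereEulerProofs

/-!
# Crux `JParityClosure.DensityCap` (stmt-AtomisticToContinuum-13082) — ideator 2 sketch (round 1)

Typed backbone of the two crux-idea cards of this seat:

* card `lipschitz-clock-free-past-cap`: `CapPropagationPathwise` (first lemma), `PackingCapUpTo`,
  `SlabClosure` (the transfer C⁺) and the free-hypothesis theorem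
  `hydroLimitInBand_of_slabClosure : SlabClosure → HydroLimitInBand` (M-sized, sorried here) with its
  trivial converse `slabClosure_of_hydroLimitInBand` (proved);
* card `equal-mass-two-sided-dock`: `PointwiseDensityLimit`, `UniformDensityLimit` and the equivalence
  chain `DensityCap → UniformDensityLimit → PointwiseDensityLimit → DensityCap` (first and third sorried,
  M-sized; second proved), plus the docks `pointwiseDensityLimit_of_inBand` (proved, pure logic) and
  `pointwiseDensityLimit_of_momentumLimit` (sorried; = item 11910 + probability of the laws).

Everything is stated over existing declarations (route decls `JParityClosure.DensityCap`,
`ImplosionDichotomy.HydroLimitInBand` = stmt-9133, `ImplosionDichotomy.DiluteSelfConsistency` = stmt-3091,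
`AdiabaticParcels.MomentumLimit` = stmt-11907, `AdiabaticParcels.DensityFromMomentum` = stmt-11910;
Literature `localGibbsLaw`, `TendstoHydroFieldsAt`, `IsHardSphereEulerSolution`, `HardSphereFlow`,
`empiricalMeasure`, `empiricalDensityField`, `Torus.euclidDist`, `hsDiameter`).
-/

noncomputable section

namespace Summit.AtomisticToContinuum.HydrodynamicLimit.Cruxes.DensityCap.IdeatorTwo

open scoped BigOperators Topology Classical MeasureTheory ENNReal
open Filter Set Function MeasureTheory
open Literature.MathematicalPhysics.KineticTheory Literature.Analysis.FluidPDE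

/-- The torus hard-sphere geometry in dimension 3 (abbreviation). -/
abbrev G3 : Geometry (Fin 3) T3 := Torus.geometry (Fin 3)

/-- The tent kernel `b_r(y, x₀) = 3/(π r³) · (1 − d(y,x₀)/r)₊` of the crux (`bx` in the route file). -/
def tent (r : ℝ) (y x₀ : T3) : ℝ :=
  3 / (Real.pi * r ^ 3) * max (1 - Torus.euclidDist y x₀ / r) 0

/-- The `r`-mollified empirical density of a configuration at `x₀` (`ρm` in the route file). -/
def mollDensity {N : ℕ} (r : ℝ) (z : Config (N + 1) (Fin 3) T3) (x₀ : T3) : ℝ :=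
  ∫ q, tent r q.1 x₀ ∂(empiricalMeasure z)

/-- Kinetic energy per particle `(N+1)⁻¹ ∑ |v_i|²/2` (= `empiricalEnergyField z 1`). -/
def kinEnergy {N : ℕ} (z : Config (N + 1) (Fin 3) T3) : ℝ :=
  ∫ q, ‖q.2‖ ^ 2 / 2 ∂(empiricalMeasure z)

/-! ## Card A — the Lipschitz clock -/

/-- FIRST LEMMA (card A). Pathwise, `N`-uniform time-Lipschitz modulus of the mollified density at a
fixed macroscopic scale `r`, driven by the conserved kinetic energy only: along every good orbit of
any hard-sphere flow, `|ρ_r(s') − ρ_r(s)| ≤ 3/(π r⁴) · √(2K) · |s' − s|` with `K` the (conserved)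
kinetic energy per particle. Positions are continuous and piecewise free (`IsHardSphereTrajectory`),
`tent r · x₀` is `3/(πr⁴)`-Lipschitz for `euclidDist`, Cauchy–Schwarz and `configEnergy_eq_holds`.
No velocity cutoff, no tail estimate (degree-2 input only). -/
def CapPropagationPathwise : Prop :=
  ∀ (σ : ℝ) (N : ℕ) (Φ : HardSphereFlow G3 (hsDiameter σ N) (N + 1)) (r : ℝ), 0 < r →
    ∀ z ∈ Φ.good, ∀ (s s' : ℝ) (x₀ : T3),
      |mollDensity r (Φ.flow s' z) x₀ - mollDensity r (Φ.flow s z) x₀|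
        ≤ 3 / (Real.pi * r ^ 4) * Real.sqrt (2 * kinEnergy z) * |s' - s|

/-- "The packing at scale `r̄` stayed below `ηb` on `[0, s]`, with high probability, eventually in `N`"
(the only thing the kinetic cutoffs of a band route need from `DensityCap`). -/
def PackingCapUpTo (σ r ηb s : ℝ) (a₀ θ₀ : T3 → ℝ) (u₀ : T3 → V3)
    (Φ : (N : ℕ) → HardSphereFlow G3 (hsDiameter σ N) (N + 1)) : Prop :=
  ∀ δ : ℝ, 0 < δ → ∃ N₀ : ℕ, ∀ N : ℕ, N₀ ≤ N →
    localGibbsLaw σ a₀ u₀ θ₀ N (Φ N)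
      {z | ∃ s' ∈ Icc 0 s, ∃ x : T3, ηb < σ ^ 3 * mollDensity r ((Φ N).flow s' z) x} ≤ ENNReal.ofReal δ

/-- TRANSFER C⁺ (card A): the SLABBED, CAP-CONDITIONED band statement. It is `HydroLimitInBand`
(stmt-9133) with guard `ρσ³ < η₀/4`, concluded one time `s` at a time, and with the EXTRA, FREE
hypothesis that the particle packing at one fixed macroscopic scale `r̄` stayed below `η₀/2` on the
past slab `[0, s]`. Any proof of the band statement may assume this hypothesis
(`hydroLimitInBand_of_slabClosure`). -/
def SlabClosure : Prop :=
  ∃ η₀ : ℝ, 0 < η₀ ∧ ∀ (a₀ θ₀ : T3 → ℝ) (u₀ : T3 → V3), Continuous a₀ → Continuous θ₀ → Continuous u₀ →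
    (∀ x, 0 < a₀ x) → (∀ x, 0 < θ₀ x) →
    ∃ σ₀ : ℝ, 0 < σ₀ ∧ ∀ σ : ℝ, 0 < σ → σ < σ₀ →
      ∀ (T : ℝ) (ρ θ : ℝ → T3 → ℝ) (u : ℝ → T3 → V3), IsHardSphereEulerSolution σ T ρ u θ →
        (∀ t ∈ Ico 0 T, ∀ x, ρ t x * σ ^ 3 < η₀ / 4) →
        ∀ Φ : (N : ℕ) → HardSphereFlow G3 (hsDiameter σ N) (N + 1),
          TendstoHydroFieldsAt (fun N => localGibbsLaw σ a₀ u₀ θ₀ N (Φ N)) Φ ρ u θ 0 →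
            ∀ r : ℝ, 0 < r → r < 1 / 2 → ∀ s ∈ Ico 0 T,
              PackingCapUpTo σ r (η₀ / 2) s a₀ θ₀ u₀ Φ →
                TendstoHydroFieldsAt (fun N => localGibbsLaw σ a₀ u₀ θ₀ N (Φ N)) Φ ρ u θ s

/-- Trivial direction: the band statement implies its cap-conditioned slab version (ignore the cap). -/
theorem slabClosure_of_hydroLimitInBand
    (h : Theses.ImplosionDichotomy.HydroLimitInBand) : SlabClosure := by
  obtain ⟨η₀, hη₀, h⟩ := h
  refine ⟨4 * η₀, by positivity, ?_⟩
  intro a₀ θ₀ u₀ ha hθ hu ha0 hθ0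
  obtain ⟨σ₀, hσ₀, hσ⟩ := h a₀ θ₀ u₀ ha hθ hu ha0 hθ0
  refine ⟨σ₀, hσ₀, ?_⟩
  intro σ hσp hσlt T ρ θ u hE hguard Φ h0 r _hr _hr2 s hs _hcap
  have hguard' : ∀ t ∈ Ico 0 T, ∀ x, ρ t x * σ ^ 3 < η₀ := by
    intro t ht x
    have := hguard t ht x
    linarith
  exact hσ σ hσp hσlt T ρ θ u hE hguard' Φ h0 s hs

/-- FREE-PAST-CAP THEOREM (card A, M-sized; the open–closed induction). `SlabClosure → HydroLimitInBand`:
fix profiles, `σ`, a guarded classical solution, flows with the `t = 0` LLN, a scale `r̄ < 1/2` and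
`t < T`; let `K̄ := ∫E(0) + 1` and `Δ := η₀ π r̄⁴ / (12 σ³ √(2K̄)) ∧ (room of the guard)/‖∂ₜρ‖∞`.
(open) `TendstoHydroFieldsAt` at a time `s'` ⇒ the packing cap `σ³ρ_{r̄}(s') ≤ η₀/4 + ε` w.h.p.,
uniformly in `x` (finite `x`-grid, `tent` is `3/(πr̄⁴)`-Lipschitz in `x₀`, test functions
`tent r̄ · x_j` are continuous, and `(ρ(s') * b_{r̄}) σ³ < η₀/4` by the guard); (closed)
`CapPropagationPathwise` + `P(kinEnergy > K̄) → 0` (energy LLN at `t = 0`, conservation) ⇒ the cap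
`≤ η₀/2` persists on `[s', s' + Δ]`; induction over `k ≤ ⌈t/Δ⌉` slabs, using `SlabClosure` at each
stage to convert "cap on `[0, kΔ]`" into "LLN at every `s' ≤ kΔ`"; union bounds over finitely many
events. Base: the cap at `s' = 0` from the `t = 0` LLN. Conclusion: `HydroLimitInBand` with band `η₀/4`. -/
theorem hydroLimitInBand_of_slabClosure (h : SlabClosure) :
    Theses.ImplosionDichotomy.HydroLimitInBand := by
  sorry

/-! ## Card B — equal mass makes the one-sided cap two-sided -/

/-- The DENSITY THIRD of the summit's conclusion, time by time (tested convergence of the empirical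
density field at every `s < T`), in the crux's own quantifier frame. -/
def PointwiseDensityLimit : Prop :=
  ∀ (a₀ θ₀ : T3 → ℝ) (u₀ : T3 → V3), Continuous a₀ → Continuous θ₀ → Continuous u₀ →
    (∀ x, 0 < a₀ x) → (∀ x, 0 < θ₀ x) →
    ∃ σ₀ : ℝ, 0 < σ₀ ∧ ∀ σ : ℝ, 0 < σ → σ < σ₀ →
      ∀ (T : ℝ) (ρ θ : ℝ → T3 → ℝ) (u : ℝ → T3 → V3), IsHardSphereEulerSolution σ T ρ u θ →
        ∀ Φ : (N : ℕ) → HardSphereFlow G3 (hsDiameter σ N) (N + 1),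
          TendstoHydroFieldsAt (fun N => localGibbsLaw σ a₀ u₀ θ₀ N (Φ N)) Φ ρ u θ 0 →
            ∀ s ∈ Ico 0 T, ∀ χ : T3 → ℝ, Continuous χ → ∀ δ : ℝ, 0 < δ →
              Tendsto (fun N => localGibbsLaw σ a₀ u₀ θ₀ N (Φ N)
                {z | δ < |empiricalDensityField ((Φ N).flow s z) χ - ∫ x, χ x * ρ s x|}) atTop (𝓝 0)

/-- The same, UNIFORMLY on `[0, t]` (sup over `s ≤ t` inside the event). -/
def UniformDensityLimit : Prop :=
  ∀ (a₀ θ₀ : T3 → ℝ) (u₀ : T3 → V3), Continuous a₀ → Continuous θ₀ → Continuous u₀ →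
    (∀ x, 0 < a₀ x) → (∀ x, 0 < θ₀ x) →
    ∃ σ₀ : ℝ, 0 < σ₀ ∧ ∀ σ : ℝ, 0 < σ → σ < σ₀ →
      ∀ (T : ℝ) (ρ θ : ℝ → T3 → ℝ) (u : ℝ → T3 → V3), IsHardSphereEulerSolution σ T ρ u θ →
        ∀ Φ : (N : ℕ) → HardSphereFlow G3 (hsDiameter σ N) (N + 1),
          TendstoHydroFieldsAt (fun N => localGibbsLaw σ a₀ u₀ θ₀ N (Φ N)) Φ ρ u θ 0 →
            ∀ t ∈ Ico 0 T, ∀ χ : T3 → ℝ, Continuous χ → ∀ δ : ℝ, 0 < δ →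
              Tendsto (fun N => localGibbsLaw σ a₀ u₀ θ₀ N (Φ N)
                {z | ∃ s ∈ Icc 0 t, δ < |empiricalDensityField ((Φ N).flow s z) χ - ∫ x, χ x * ρ s x|})
                atTop (𝓝 0)

/-- CORE OF CARD B (proved): on a probability space, equal total mass turns the ONE-SIDED cap
`f ≤ g + η` into the TWO-SIDED bound `‖f − g‖_{L¹} ≤ 2η` (apply with `f = ρ_r^N(s,·)`, `g = ρ(s,·)`). -/
theorem integral_abs_sub_le_of_cap {f g : T3 → ℝ} {η : ℝ} (hη : 0 ≤ η) (hf : Integrable f)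
    (hg : Integrable g) (hint : ∫ x, f x = ∫ x, g x) (hcap : ∀ x, f x ≤ g x + η) :
    ∫ x, |f x - g x| ≤ 2 * η := by
  haveI : IsProbabilityMeasure (volume : Measure T3) := inferInstance
  have hpt : ∀ x, |f x - g x| ≤ (g x - f x) + 2 * η := by
    intro x
    have hx := hcap x
    rcases le_or_gt (g x) (f x) with h | h
    · rw [abs_of_nonneg (sub_nonneg.2 h)]; linarith
    · rw [abs_of_neg (sub_neg.2 h)]; linarith
  have hgf : Integrable (fun x => g x - f x) := hg.sub hf
  have h1 : ∫ x, |f x - g x| ≤ ∫ x, ((g x - f x) + 2 * η) :=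
    integral_mono (hf.sub hg).abs (hgf.add (integrable_const _)) hpt
  have h2 : ∫ x, ((g x - f x) + 2 * η) = (∫ x, (g x - f x)) + ∫ _x : T3, (2 * η) :=
    integral_add hgf (integrable_const _)
  have h3 : ∫ x, (g x - f x) = (∫ x, g x) - ∫ x, f x := integral_sub hg hf
  have h4 : ∫ _x : T3, (2 * η) = 2 * η := by simp
  linarith [h1, h2, h3, h4, hint]

/-- Uniform ⇒ pointwise (monotonicity of measures; proved). -/
theorem pointwiseDensityLimit_of_uniform (h : UniformDensityLimit) : PointwiseDensityLimit := by
  intro a₀ θ₀ u₀ ha hθ hu ha0 hθ0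
  obtain ⟨σ₀, hσ₀, hσ⟩ := h a₀ θ₀ u₀ ha hθ hu ha0 hθ0
  refine ⟨σ₀, hσ₀, ?_⟩
  intro σ hσp hσlt T ρ θ u hE Φ h0 s hs χ hχ δ hδ
  have hsT : s ∈ Ico 0 T := hs
  have hlim := hσ σ hσp hσlt T ρ θ u hE Φ h0 s hsT χ hχ δ hδ
  refine tendsto_of_tendsto_of_tendsto_of_le_of_le tendsto_const_nhds hlim (fun N => zero_le) ?_
  intro N
  refine measure_mono ?_
  intro z hz
  exact ⟨s, ⟨hs.1, le_rfl⟩, hz⟩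

/-- FIRST LEMMA (card B, M-sized). EQUAL MASS TURNS THE CAP TWO-SIDED: `DensityCap → UniformDensityLimit`.
On the cap event `{∀ s ≤ t ∀ x, ρ_r(s,x) ≤ ρ(s,x) + η}` one has `∫ρ_r(s,·) = 1` (the tent integrates to
`1` for `r < 1/2`, total empirical mass `1`) and `∫ρ(s,·) = 1` (Euler mass conservation + the `t = 0`
LLN with `χ = 1`, laws being probability measures for `σ ≤ 1/2`), hence `‖ρ_r(s) − ρ(s)‖_{L¹} ≤ 2η`
for every `s ≤ t` simultaneously; then `|⟨ρ_N(s), χ⟩ − ∫χρ(s)| ≤ |⟨ρ_N(s), χ − χ*b_r⟩| + ‖χ‖∞ 2η +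
|∫(χ*b_r − χ)ρ(s)| ≤ 2ω_χ(r) + 2η‖χ‖∞`. Choose `η`, then `r < r₀(η,δ)` from `DensityCap`. -/
theorem uniformDensityLimit_of_densityCap (h : Theses.JParityClosure.DensityCap) :
    UniformDensityLimit := by
  sorry

/-- CONVERSE (card B, M-sized; the refuter's §4 argument, rattack-13082): `PointwiseDensityLimit →
DensityCap`. Energy LLN at `t = 0` + conservation give `P(kinEnergy > K̄) → 0`; on `{kinEnergy ≤ K̄}`
the field `(s, x) ↦ ρ_r(s, x)` is `3√(2K̄)/(πr⁴)`-Lipschitz in `s` (`CapPropagationPathwise`) and in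
`x`; a finite `(s, x)`-grid of `N`-independent size, the pointwise LLN at the grid times with the
continuous test functions `tent r · x_j`, `ρ * b_r ≤ ρ + η/2` for `r < r₀(η)` (uniform continuity of
`ρ` on `[0,t] × 𝕋³`), and a union bound. -/
theorem densityCap_of_pointwiseDensityLimit (h : PointwiseDensityLimit) :
    Theses.JParityClosure.DensityCap := by
  sorry

/-- DOCK 1 (proved, pure logic): the band statement (stmt-9133) and the packing guard (stmt-3091)
give the pointwise density limit — hence, with `densityCap_of_pointwiseDensityLimit`, `DensityCap`. -/
theorem pointwiseDensityLimit_of_inBand (hB : Theses.ImplosionDichotomy.HydroLimitInBand)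
    (hD : Theses.ImplosionDichotomy.DiluteSelfConsistency) : PointwiseDensityLimit := by
  obtain ⟨η₀, hη₀, hB⟩ := hB
  intro a₀ θ₀ u₀ ha hθ hu ha0 hθ0
  obtain ⟨σ₁, hσ₁, h1⟩ := hB a₀ θ₀ u₀ ha hθ hu ha0 hθ0
  obtain ⟨σ₂, hσ₂, h2⟩ := hD η₀ hη₀ a₀ θ₀ u₀ ha hθ hu ha0 hθ0
  refine ⟨min σ₁ σ₂, lt_min hσ₁ hσ₂, ?_⟩
  intro σ hσp hσlt T ρ θ u hE Φ h0 s hs χ hχ δ hδ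
  have hσ1 : σ < σ₁ := lt_of_lt_of_le hσlt (min_le_left _ _)
  have hσ2 : σ < σ₂ := lt_of_lt_of_le hσlt (min_le_right _ _)
  have hguard : ∀ t ∈ Ico 0 T, ∀ x, ρ t x * σ ^ 3 < η₀ := h2 σ hσp hσ2 T ρ θ u hE Φ h0
  have hfull := h1 σ hσp hσ1 T ρ θ u hE hguard Φ h0 s hs
  exact (hfull χ hχ δ hδ).1

/-- DOCK 2 (proved modulo the provable-now item 11910 taken as hypothesis): the MOMENTUM third alone suffices — `AdiabaticParcels.MomentumLimit` (stmt-11907)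
gives the pointwise density limit through the free continuity equation `DensityFromMomentum`
(stmt-11910, provable now) and `isProbabilityMeasure_localGibbsLaw` (σ ≤ 1/2). -/
theorem pointwiseDensityLimit_of_momentumLimit
    (hC : Theses.AdiabaticParcels.DensityFromMomentum)
    (hM : Theses.AdiabaticParcels.MomentumLimit) : PointwiseDensityLimit := by
  intro a₀ θ₀ u₀ ha hθ hu ha0 hθ0
  obtain ⟨σ₀, hσ₀, hσ⟩ := hM a₀ θ₀ u₀ ha hθ hu ha0 hθ0
  refine ⟨min σ₀ (1 / 2), lt_min hσ₀ (by norm_num), ?_⟩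
  intro σ hσp hσlt T ρ θ u hE Φ h0 s hs χ hχ δ hδ
  have hσ1 : σ < σ₀ := lt_of_lt_of_le hσlt (min_le_left _ _)
  have hσ2 : σ ≤ 1 / 2 := (lt_of_lt_of_le hσlt (min_le_right _ _)).le
  have hP : ∀ N, IsProbabilityMeasure (localGibbsLaw σ a₀ u₀ θ₀ N (Φ N)) :=
    fun N => isProbabilityMeasure_localGibbsLaw ha hθ hu ha0 hθ0 hσ2 N (Φ N)
  have hmom := hσ σ hσp hσ1 T ρ θ u hE Φ hP h0
  exact hC σ a₀ θ₀ u₀ hσp T ρ θ u hE Φ hP h0 hmom s hs χ hχ δ hδ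

/-- Summary of card B as one statement: the crux IS the density third of the conjunct. -/
theorem densityCap_iff_pointwiseDensityLimit :
    Theses.JParityClosure.DensityCap ↔ PointwiseDensityLimit :=
  ⟨fun h => pointwiseDensityLimit_of_uniform (uniformDensityLimit_of_densityCap h),
   fun h => densityCap_of_pointwiseDensityLimit h⟩

end Summit.AtomisticToContinuum.HydrodynamicLimit.Cruxes.DensityCap.IdeatorTwo

end
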